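import Literature.NumberTheory.Automorphic.Liu2021.AppendixC.Thm415Pinned
import HarnessLib

/-!
# [Liu 2021, §4.3] the `ℓ`-adic Hom-space `Hom_{ℚ_ℓ^{ac}[𝔾]}(ι_ℓ ∘ ω, H¹_ét(A_∞, ℚ_ℓ^{ac}))` versus the Betti multiplicity space
# `Hom_{ℂ[𝔾]}(ω, H¹_{B,τ'}(A_∞, ℂ))` under the comparison isomorphism: same rank

Topic `NumberTheory/Automorphic/Liu2021/AppendixC`; namespace `Literature.NumberTheory.Automorphic.Liu2021.AppendixC`.
THEOREMS ONLY (no `def`, no named fact, no `sorry`); cell `hodgecm-mathlib`, line `a3_liu418` (item hLiu418 =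
[Liu 2021, Thm 4.18]), v15 (S)-split node **MULT1** (director g4 RULING s71 (1), 2026-08-28): the GENERIC HALF of the bridge
«floor row III-J3a `multiplicity_le_one_printed` (Betti currency `Module.rank ℂ (IntertwiningMap (P.rhoAt t) (P.rhoB τ')) ≤ 1`)
⟹ `Module.finrank ℚ_ℓ^{ac} (X.omegaHom ι ρ) ≤ 1` (ℓ-adic currency of `Thm415Pinned` / `Thm415Frobenius`)».

PRINT (Y. Liu, *Fourier–Jacobi cycles and arithmetic relative trace formula*, Camb. J. Math. 9 (2021), `FJcycle.tex`), §4.3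
l. 2152–2168: «We fix an isomorphism `ι_ℓ : ℂ ≅ ℚ_ℓ^{ac}`. We have a canonical isomorphism
`H¹_ét(A_K ⊗_{E,τ'} ℂ, ℚ_ℓ^{ac}) ≃ H¹_{B,τ'}(A_K, ℂ) ⊗_{ℂ,ι_ℓ} ℚ_ℓ^{ac}` by the comparison theorem. […] Then
`Hom_{ℚ_ℓ^{ac}[𝔾(𝔸_F^∞)]}(ι_ℓ ∘ ω(μ,ε,χ), H¹_ét(A_∞ ⊗_{E,τ'} ℂ, ℚ_ℓ^{ac}))` is a representation of `Gal(ℂ/τ'(E))` over `ℚ_ℓ^{ac}`. By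
Proposition 4.13, such representation is an `ℓ`-adic character» — i.e. the `ℓ`-adic Hom-space has the SAME dimension (one) as the
Betti multiplicity space of Prop. 4.13, BECAUSE the comparison isomorphism is `𝔾(𝔸_F^∞)`-equivariant.  This file proves exactly that
transfer, for the tree's carriers: `X.omegaHom ι ρW` (`Thm415Pinned.lean` :158, the `ℚ_ℓ^{ac}`-module of `ι`-semilinear `C.G`-maps
`W → ℚ_ℓ^{ac} ⊗_{ℚ_ℓ} H¹_ét(A_∞)`) and a Betti comparison `B : C.BettiComparison ℓ X H rhoB ι` (`EtaleH1Tower.lean` :286: an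
`ι`-semilinear BIJECTION `cmp : H → ℚ_ℓ^{ac} ⊗ H¹_ét(A_∞)` intertwining `rhoB` with `X.rhoEt`).

CONTENT (all `C`, `X`, `ι`, `(H, rhoB)`, `B`, `(W, ρW)` arbitrary):
* `comp_mem_omegaHom` — `φ ↦ cmp ∘ φ` maps `Hom_{ℂ[G]}(ρW, rhoB)` (Mathlib `Representation.IntertwiningMap ρW rhoB`) into
  `X.omegaHom ι ρW`; `comp_injective`; `exists_comp_eq` — it is onto (inverse `f ↦ cmp⁻¹ ∘ f`, which is `ℂ`-linear because `cmp`
  is `ι`-semilinear and bijective, and `C.G`-equivariant by `B.comm`);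
* `rank_omegaHom_eq` — `Module.rank ℚ_ℓ^{ac} (X.omegaHom ι ρW) = Module.rank ℂ (IntertwiningMap ρW rhoB)` (Mathlib
  `rank_eq_of_equiv_equiv` along the ring isomorphism `ι`: the bijection is `ι`-semilinear), `finrank_omegaHom_eq`;
* the consumer shapes `rank_omegaHom_le_one` ∕ `finrank_omegaHom_le_one` (hypothesis = the `≤ 1` of
  `Prop413Data.multiplicity_le_one_printed`, `Prop413MultiplicityLeOnePrinted.lean` :77–79, read at `(ρW, rhoB)`), and
  `EtaleHeckeDatum.exists_eq_smul_of_rank_omegaHom_le_one` (∕ `_finrank_`) — in a Hom-space of rank `≤ 1` every member is a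
  multiple of any non-zero member (the `hspan` input of the per-`f` transfer `S5Transfer` of the v15 glue), and
  `BettiComparison.mult1Line_of_rank_le_one` — the v15 registered node `Mult1OmegaHom` in its exact LINE FORM
  «`∀ f ∈ Hom, ∀ g ∈ Hom, f ≠ 0 → ∃ b, g = b • f`» (A-plan1, `a3-liu418.v15.generic-layer.lean` l. 97–104) for any `ρW`, from the
  Betti bound through `B`.
The FACE HALF (which `(H, rhoB)` the h413 pin compares to the induced `X`, and `P.rhoAt t` versus `(UV …).rho ν hν ε χ`) is NOT
here (A-p09's census, `Theorems/HLiu418Mult1OfMultiplicityLeOnePrinted.lean`).  HC_CM is proved only modulo the 7 printed citations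
until rung 0 closes; this file discharges none of them.

## References
* [Liu2021] Y. Liu, Camb. J. Math. **9** (2021) 1–147 = arXiv:2102.11518, §4.3 (`FJcycle.tex` l. 2152–2168), Prop. 4.13 (l. 2113–2146).
* Tree: `Sec42Data.EtaleHeckeDatum.omegaHom`, `Sec42Data.BettiComparison` (`AppendixC/Thm415Pinned.lean`, `AppendixC/EtaleH1Tower.lean`),
  `Prop413Data.multiplicity_le_one_printed` (`Liu2021/Prop413MultiplicityLeOnePrinted.lean`).
-/

noncomputable section

open NumberField
open scoped TensorProduct

namespace Literature.NumberTheory.Automorphic.Liu2021.AppendixC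

variable {F E : Type} [Field F] [NumberField F] [IsTotallyReal F] [Field E] [NumberField E] [Algebra F E]
  [IsTotallyComplex E] [Algebra.IsQuadraticExtension F E]
variable {P5 : PropC5Data F E} {isotropicAt : ℕ → Prop}

namespace Sec42Data

variable {C : Sec42Data P5 isotropicAt} {ℓ : ℕ} [Fact ℓ.Prime] {X : C.EtaleHeckeDatum ℓ}
  {H : Type} [AddCommGroup H] [Module ℂ H] {rhoB : Representation ℂ C.G H} {ι : ℂ ≃+* AlgebraicClosure ℚ_[ℓ]}
  {W : Type} [AddCommGroup W] [Module ℂ W]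

namespace EtaleHeckeDatum

/-- In a Hom-space `Hom_{ℚ_ℓ^{ac}[𝔾]}(ι_ℓ ∘ ω, ℚ_ℓ^{ac} ⊗ H¹_ét(A_∞))` of rank `≤ 1` («such representation is an `ℓ`-adic character»,
l. 2166–2168), every member is a scalar multiple of any NON-ZERO member — the `hspan` shape consumed by the per-`f` Galois transfer
of the v15 (S)-split.  (The `Module.Free` instance on the subspace is supplied by hand: instance search for it times out on these
carriers.) [cite: Liu2021, §4.3 (FJcycle.tex l. 2166–2168)] -/
theorem exists_eq_smul_of_rank_omegaHom_le_one (X : C.EtaleHeckeDatum ℓ) (ι : ℂ ≃+* AlgebraicClosure ℚ_[ℓ])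
    (ρW : Representation ℂ C.G W)
    (h : Module.rank (AlgebraicClosure ℚ_[ℓ]) (X.omegaHom ι ρW) ≤ 1)
    {f : W →ₛₗ[(ι : ℂ →+* AlgebraicClosure ℚ_[ℓ])] AlgebraicClosure ℚ_[ℓ] ⊗[ℚ_[ℓ]] C.etaleH1Tower ℓ}
    (hf : f ∈ X.omegaHom ι ρW) (hf0 : f ≠ 0) :
    ∀ g ∈ X.omegaHom ι ρW, ∃ b : AlgebraicClosure ℚ_[ℓ], g = b • f := by
  haveI : Module.Free (AlgebraicClosure ℚ_[ℓ]) (X.omegaHom ι ρW) :=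
    @Module.Free.of_divisionRing _ _ _ (Submodule.addCommGroup _) _
  obtain ⟨v₀, -, hv₀⟩ := (rank_submodule_le_one_iff _).mp h
  obtain ⟨a, ha⟩ := Submodule.mem_span_singleton.mp (hv₀ hf)
  have ha0 : a ≠ 0 := by
    rintro rfl
    exact hf0 (by simpa using ha.symm)
  intro g hg
  obtain ⟨b, hb⟩ := Submodule.mem_span_singleton.mp (hv₀ hg)
  refine ⟨b * a⁻¹, ?_⟩
  rw [← hb, ← ha, smul_smul, mul_assoc, inv_mul_cancel₀ ha0, mul_one]

/-- `finrank` variant of `exists_eq_smul_of_rank_omegaHom_le_one` for a FINITE-dimensional Hom-space (the v15 stub currency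
`Module.finrank _ (X.omegaHom ι ρ) ≤ 1` together with `Module.Finite`). [cite: Liu2021, §4.3 (FJcycle.tex l. 2166–2168)] -/
theorem exists_eq_smul_of_finrank_omegaHom_le_one (X : C.EtaleHeckeDatum ℓ) (ι : ℂ ≃+* AlgebraicClosure ℚ_[ℓ])
    (ρW : Representation ℂ C.G W) [Module.Finite (AlgebraicClosure ℚ_[ℓ]) (X.omegaHom ι ρW)]
    (h : Module.finrank (AlgebraicClosure ℚ_[ℓ]) (X.omegaHom ι ρW) ≤ 1)
    {f : W →ₛₗ[(ι : ℂ →+* AlgebraicClosure ℚ_[ℓ])] AlgebraicClosure ℚ_[ℓ] ⊗[ℚ_[ℓ]] C.etaleH1Tower ℓ}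
    (hf : f ∈ X.omegaHom ι ρW) (hf0 : f ≠ 0) :
    ∀ g ∈ X.omegaHom ι ρW, ∃ b : AlgebraicClosure ℚ_[ℓ], g = b • f := by
  haveI : Module.Free (AlgebraicClosure ℚ_[ℓ]) (X.omegaHom ι ρW) :=
    @Module.Free.of_divisionRing _ _ _ (Submodule.addCommGroup _) _
  refine X.exists_eq_smul_of_rank_omegaHom_le_one ι ρW ?_ hf hf0
  rw [← Module.finrank_eq_rank (AlgebraicClosure ℚ_[ℓ]) (X.omegaHom ι ρW)]
  exact_mod_cast h

end EtaleHeckeDatum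

namespace BettiComparison

/-- `φ ↦ cmp ∘ φ` carries a `ℂ[𝔾]`-intertwiner `ω → H¹_{B,τ'}(A_∞, ℂ)` to an element of
`Hom_{ℚ_ℓ^{ac}[𝔾]}(ι_ℓ ∘ ω, ℚ_ℓ^{ac} ⊗ H¹_ét(A_∞))` (the comparison is `𝔾`-equivariant, `B.comm`).
[cite: Liu2021, §4.3 (FJcycle.tex l. 2152–2165)] -/
theorem comp_mem_omegaHom (B : C.BettiComparison ℓ X H rhoB ι) (ρW : Representation ℂ C.G W)
    (φ : Representation.IntertwiningMap ρW rhoB) :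
    B.cmp.comp φ.toLinearMap ∈ X.omegaHom ι ρW := by
  intro g w
  simp only [LinearMap.coe_comp, Function.comp_apply, Representation.IntertwiningMap.coe_toLinearMap,
    Representation.IntertwiningMap.isIntertwining ρW rhoB φ g w, B.comm g]

/-- `φ ↦ cmp ∘ φ` is injective (the comparison map is injective). [cite: Liu2021, §4.3 (FJcycle.tex l. 2154)] -/
theorem comp_injective (B : C.BettiComparison ℓ X H rhoB ι) (ρW : Representation ℂ C.G W) :
    Function.Injective fun φ : Representation.IntertwiningMap ρW rhoB => B.cmp.comp φ.toLinearMap := by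
  intro φ ψ h
  ext w
  exact B.injective (by simpa using LinearMap.congr_fun h w)

/-- `φ ↦ cmp ∘ φ` is onto `Hom_{ℚ_ℓ^{ac}[𝔾]}(ι_ℓ ∘ ω, ℚ_ℓ^{ac} ⊗ H¹_ét(A_∞))`: `f ↦ cmp⁻¹ ∘ f` is `ℂ`-linear (the comparison is an
`ι`-semilinear bijection along the ISOMORPHISM `ι_ℓ`) and `𝔾`-equivariant (`B.comm`). [cite: Liu2021, §4.3 (FJcycle.tex l. 2152–2165)] -/
theorem exists_comp_eq (B : C.BettiComparison ℓ X H rhoB ι) (ρW : Representation ℂ C.G W)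
    {f : W →ₛₗ[(ι : ℂ →+* AlgebraicClosure ℚ_[ℓ])] AlgebraicClosure ℚ_[ℓ] ⊗[ℚ_[ℓ]] C.etaleH1Tower ℓ}
    (hf : f ∈ X.omegaHom ι ρW) :
    ∃ φ : Representation.IntertwiningMap ρW rhoB, B.cmp.comp φ.toLinearMap = f := by
  let e : H ≃ AlgebraicClosure ℚ_[ℓ] ⊗[ℚ_[ℓ]] C.etaleH1Tower ℓ := Equiv.ofBijective B.cmp B.bijective
  have he : ∀ t, B.cmp (e.symm t) = t := e.apply_symm_apply
  let ψ : W →ₗ[ℂ] H :=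
    { toFun := fun w => e.symm (f w)
      map_add' := fun w₁ w₂ => B.injective (by rw [he, map_add, map_add, he, he])
      map_smul' := fun a w => B.injective (by
        rw [he, LinearMap.map_smulₛₗ, LinearMap.map_smulₛₗ, he, RingHom.id_apply]) }
  have hψ : ∀ (g : C.G) (w : W), ψ (ρW g w) = rhoB g (ψ w) := fun g w =>
    B.injective (by
      change B.cmp (e.symm (f (ρW g w))) = B.cmp (rhoB g (e.symm (f w)))
      rw [he, hf g w, B.comm g, he])
  refine ⟨ψ.intertwiningMap_of_isIntertwiningMap ρW rhoB hψ, ?_⟩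
  ext w
  exact he (f w)

/-- **Same rank**: `dim_{ℚ_ℓ^{ac}} Hom_{ℚ_ℓ^{ac}[𝔾]}(ι_ℓ ∘ ω, ℚ_ℓ^{ac} ⊗ H¹_ét(A_∞)) = dim_ℂ Hom_{ℂ[𝔾]}(ω, H¹_{B,τ'}(A_∞, ℂ))` under the
`𝔾`-equivariant comparison isomorphism (l. 2154–2160) — the `ι`-semilinear additive bijection `φ ↦ cmp ∘ φ` and Mathlib's
`rank_eq_of_equiv_equiv` along the ring isomorphism `ι_ℓ : ℂ ≅ ℚ_ℓ^{ac}`.  This is why «By Proposition 4.13, such representation is an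
`ℓ`-adic character» (l. 2166–2168). [cite: Liu2021, §4.3 (FJcycle.tex l. 2152–2168)] -/
theorem rank_omegaHom_eq (B : C.BettiComparison ℓ X H rhoB ι) (ρW : Representation ℂ C.G W) :
    Module.rank (AlgebraicClosure ℚ_[ℓ]) (X.omegaHom ι ρW) =
      Module.rank ℂ (Representation.IntertwiningMap ρW rhoB) := by
  let Φ : Representation.IntertwiningMap ρW rhoB →+ X.omegaHom ι ρW :=
    { toFun := fun φ => ⟨B.cmp.comp φ.toLinearMap, B.comp_mem_omegaHom ρW φ⟩
      map_zero' := by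
        ext w
        simp
      map_add' := fun φ ψ => by
        ext w
        simp }
  have hΦ : Function.Bijective Φ := by
    refine ⟨fun φ ψ h => B.comp_injective ρW (congrArg Subtype.val h), fun f => ?_⟩
    obtain ⟨φ, hφ⟩ := B.exists_comp_eq ρW f.2
    exact ⟨φ, Subtype.ext hφ⟩
  refine (rank_eq_of_equiv_equiv ι (AddEquiv.ofBijective Φ hΦ) ι.bijective fun a φ => ?_).symm
  ext w
  simp [Φ]

/-- `finrank` form of `rank_omegaHom_eq`. [cite: Liu2021, §4.3 (FJcycle.tex l. 2152–2168)] -/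
theorem finrank_omegaHom_eq (B : C.BettiComparison ℓ X H rhoB ι) (ρW : Representation ℂ C.G W) :
    Module.finrank (AlgebraicClosure ℚ_[ℓ]) (X.omegaHom ι ρW) =
      Module.finrank ℂ (Representation.IntertwiningMap ρW rhoB) :=
  congrArg Cardinal.toNat (B.rank_omegaHom_eq ρW)

/-- **MULT1 transfer, rank form**: multiplicity `≤ 1` of `ω` in `H¹_{B,τ'}(A_∞, ℂ)` (the currency of the floor row III-J3a
`Prop413Data.multiplicity_le_one_printed`: `Module.rank ℂ (IntertwiningMap (P.rhoAt t) (P.rhoB τ')) ≤ 1`) gives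
`Module.rank ℚ_ℓ^{ac} Hom_{ℚ_ℓ^{ac}[𝔾]}(ι_ℓ ∘ ω, ℚ_ℓ^{ac} ⊗ H¹_ét(A_∞)) ≤ 1`. [cite: Liu2021, §4.3 (FJcycle.tex l. 2166–2168); Prop. 4.13 (l. 2145)] -/
theorem rank_omegaHom_le_one (B : C.BettiComparison ℓ X H rhoB ι) (ρW : Representation ℂ C.G W)
    (h : Module.rank ℂ (Representation.IntertwiningMap ρW rhoB) ≤ 1) :
    Module.rank (AlgebraicClosure ℚ_[ℓ]) (X.omegaHom ι ρW) ≤ 1 := by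
  rw [B.rank_omegaHom_eq ρW]
  exact h

/-- **MULT1 transfer, `finrank` form** (the v15 stub currency `Module.finrank _ (X.omegaHom ι ρ) ≤ 1`).
[cite: Liu2021, §4.3 (FJcycle.tex l. 2166–2168); Prop. 4.13 (l. 2145)] -/
theorem finrank_omegaHom_le_one (B : C.BettiComparison ℓ X H rhoB ι) (ρW : Representation ℂ C.G W)
    (h : Module.rank ℂ (Representation.IntertwiningMap ρW rhoB) ≤ 1) :
    Module.finrank (AlgebraicClosure ℚ_[ℓ]) (X.omegaHom ι ρW) ≤ 1 :=
  Module.finrank_le_of_rank_le (by simpa using B.rank_omegaHom_le_one ρW h)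


/-- **MULT1 in LINE FORM** — the exact shape of the v15 registered node `Mult1OmegaHom` (A-plan1, `a3-liu418.v15.generic-layer.lean`
l. 97–104: `∀ f ∈ Hom, ∀ g ∈ Hom, f ≠ 0 → ∃ b, g = b • f`) for ANY `ρW`, from the Betti multiplicity bound `≤ 1` (floor row III-J3a
currency) through the comparison `B`. [cite: Liu2021, §4.3 (FJcycle.tex l. 2152–2168); Prop. 4.13 (l. 2145)] -/
theorem mult1Line_of_rank_le_one (B : C.BettiComparison ℓ X H rhoB ι) (ρW : Representation ℂ C.G W)
    (h : Module.rank ℂ (Representation.IntertwiningMap ρW rhoB) ≤ 1) :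
    ∀ f ∈ X.omegaHom ι ρW, ∀ g ∈ X.omegaHom ι ρW, f ≠ 0 → ∃ b : AlgebraicClosure ℚ_[ℓ], g = b • f :=
  fun _f hf g hg hf0 => X.exists_eq_smul_of_rank_omegaHom_le_one ι ρW (B.rank_omegaHom_le_one ρW h) hf hf0 g hg

end BettiComparison

end Sec42Data

end Literature.NumberTheory.Automorphic.Liu2021.AppendixC
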